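import Literature.Probability.Percolation.SiteCoveringExploration
import Literature.Probability.Percolation.CoveringMonotonicityMulti
import HarnessLib

/-!
# Covering maps and SITE percolation, II: the `m` copies of a vertex, read one at a time
# (Gomes–Pereira–Sanchis 2026, Lemma 2; Martineau–Severo 2019, §5)

Topic `Literature/Probability/Percolation`; bookkeeping definitions of one proof and their lemmas — no
new facts, no `sorry`. Second file of the site version of the covering theorem (first file:
`SiteCoveringExploration.lean`).

For the `m`-fold lifting property (`LyonsPeres647Multi.MultiLift`: every `H`-neighbour of `φ v` has `m`
distinct lifts adjacent to `v`) the site coupling of Gomes–Pereira–Sanchis (J. Appl. Probab. 63 (2026),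
§4.3, Lemma 2: `θ^s_d(p) ≥ θ^s_k(p̃)`, `(1-p̃) = (1-p)^{d/k}`) compares site percolation with density
`q` upstairs with site percolation with density `1 - (1-q)^m` downstairs. As in the tree's bond version
(`CoveringMonotonicityMulti.lean`) we realise the latter as the OR-aggregate (`orAggr`,
`sitePercolation_map_orAggr`) of i.i.d. `Ber(q)` coins on `W × Fin m` — Martineau–Severo's device
(Ann. Probab. 47 (2019), §5) of `M` copies read one coin at a time — so that both explorations ask one
coin per step:

* `LyonsPeres647Site.stratHm` — downstairs, on the coins `W × Fin m`: the macro-state is the replay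
  `LyonsPeres647Site.stateOf` of the COMPRESSED transcript (`LyonsPeres647Multi.split`: one Boolean per
  completed block of `m` answers, their OR), and the next query reads the next copy of the vertex chosen by
  `LyonsPeres647Site.nextPair`;
* `stratHm_freshAlong` — no coin is read twice;
* `split_run_mul` — after `m K` steps the compressed transcript IS the `K`-step transcript of the one-coin
  exploration `LyonsPeres647Site.stratH` of the aggregated configuration, whence the exhaustion lemma
  transfers (`exists_le_card_A_m`).

## References

* [GomesPereiraSanchis2026] Gomes–Pereira–Sanchis, J. Appl. Probab. 63 (2026) 61–72, §4.3 Lemma 2.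
* [MartineauSevero2019] S. Martineau, F. Severo, Ann. Probab. 47 (2019), §5 (the multigraphs `𝒢̂`,
  `ℋ̂`; "No vertex or edge will get explored more than once").
* [LyonsPeres2016] Lyons–Peres, *Probability on Trees and Networks*, §6.9 Thm. 6.47 (site version).
-/

noncomputable section

namespace Literature.Probability.Percolation

open MeasureTheory ProbabilityTheory
open scoped ENNReal Classical

namespace LyonsPeres647Site

open LyonsPeres647 (run_succ_of_none run_succ_of_some answer_singleton)
open LyonsPeres647Multi (split split_nil split_cons_of_eq split_cons_of_ne length_split_snd_lt
  split_fst_cons)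

/-! ### The exploration of the cluster of `o` with `m` copies of every vertex, one at a time -/

section HSide

variable {W : Type*} (H : SimpleGraph W) (ι : W → ℕ) (o : W) (m : ℕ) [NeZero m]

/-- The exploration downstairs on the coins `W × Fin m` (the copies of the vertices of `W`): the
macro-state is the replay `LyonsPeres647Site.stateOf` of the COMPRESSED transcript; the next query reads
the next copy of the vertex `LyonsPeres647Site.nextPair` chooses.
[cite: MartineauSevero2019, §5 (Step 2K+1)] [cite: GomesPereiraSanchis2026, §4.3 proof of Lemma 2] -/
def stratHm : CoinStrategy (W × Fin m) :=
  ⟨fun b => (nextPair H ι (stateOf H ι o (split m b).1)).map fun q =>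
    ⟨{(q.2, Fin.ofNat m (split m b).2.length)}, true⟩⟩

variable {H ι o m}

/-- The next query downstairs. [cite: MartineauSevero2019, §5 (Step 2K+1)] -/
theorem stratHm_next (b : List Bool) :
    (stratHm H ι o m).next b = (nextPair H ι (stateOf H ι o (split m b).1)).map fun q =>
      ⟨{(q.2, Fin.ofNat m (split m b).2.length)}, true⟩ := rfl

/-- **The coins read downstairs**: a copy of an examined vertex, or an earlier copy of the vertex being
examined. [cite: MartineauSevero2019, §5 ("No vertex or edge will get explored more than once")] -/
theorem used_stratHm_subset (b : List Bool) :
    ∀ f ∈ (stratHm H ι o m).used b, f.1 ∈ (stateOf H ι o (split m b).1).Q ∨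
      ∃ q, nextPair H ι (stateOf H ι o (split m b).1) = some q ∧ f.1 = q.2 ∧
        (f.2 : ℕ) < (split m b).2.length := by
  induction b with
  | nil => simp [CoinStrategy.used]
  | cons a b ih =>
    intro f hf
    rw [CoinStrategy.used, stratHm_next] at hf
    have hlt : (split m b).2.length < m := length_split_snd_lt (NeZero.pos m) b
    cases h : nextPair H ι (stateOf H ι o (split m b).1) with
    | none =>
      rw [h] at hf
      -- nothing was asked: the compressed transcript may only grow by a block on which `stateOf` stalls
      have hσ : stateOf H ι o (split m (a :: b)).1 = stateOf H ι o (split m b).1 := by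
        rcases split_fst_cons (m := m) a b with h1 | ⟨a', h1⟩
        · rw [h1]
        · rw [h1, stateOf_cons_of_none h]
      rcases ih f hf with h1 | ⟨q, hq, -, -⟩
      · rw [hσ]; exact Or.inl h1
      · rw [h] at hq; exact absurd hq (by simp)
    | some q =>
      rw [h] at hf
      simp only [Option.map_some, Finset.mem_union, Finset.mem_singleton] at hf
      by_cases hc : (split m b).2.length + 1 = m
      · -- the block of `q.2` is complete: the vertex becomes examined
        rw [split_cons_of_eq hc, stateOf_cons_of_some h]
        have hQ : q.2 ∈ (xstep (stateOf H ι o (split m b).1) q ((a :: (split m b).2).any id)).Q :=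
          Finset.mem_insert_self _ _
        have hQ' : ∀ e ∈ (stateOf H ι o (split m b).1).Q,
            e ∈ (xstep (stateOf H ι o (split m b).1) q ((a :: (split m b).2).any id)).Q := fun e he =>
          Finset.mem_insert_of_mem he
        rcases hf with rfl | hf
        · exact Or.inl hQ
        · rcases ih f hf with h1 | ⟨q', hq', he, -⟩
          · exact Or.inl (hQ' _ h1)
          · rw [h] at hq'; cases hq'
            rw [he]; exact Or.inl hQ
      · rw [split_cons_of_ne hc]
        rcases hf with rfl | hf
        · refine Or.inr ⟨q, h, rfl, ?_⟩
          simp [Nat.mod_eq_of_lt hlt]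
        · rcases ih f hf with h1 | ⟨q', hq', he, hj⟩
          · exact Or.inl h1
          · rw [h] at hq'; cases hq'
            refine Or.inr ⟨q, h, he, ?_⟩
            simp only [List.length_cons]; omega

/-- **No coin is read twice downstairs.** [cite: MartineauSevero2019, §5 (Condition 1)] -/
theorem stratHm_freshAlong : (stratHm H ι o m).FreshAlong := by
  intro b Qy _ hQ
  rw [stratHm_next] at hQ
  have hlt : (split m b).2.length < m := length_split_snd_lt (NeZero.pos m) b
  cases h : nextPair H ι (stateOf H ι o (split m b).1) with
  | none => rw [h] at hQ; simp at hQ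
  | some q =>
    rw [h] at hQ
    simp only [Option.map_some, Option.some.injEq] at hQ
    subst hQ
    simp only [Finset.disjoint_singleton_left]
    intro hmem
    rcases used_stratHm_subset b _ hmem with h1 | ⟨q', hq', -, hj⟩
    · exact (nextPair_mem h).2.2.2 h1
    · simp [Nat.mod_eq_of_lt hlt] at hj

/-! ### The compressed transcript downstairs is the transcript of the one-coin exploration of the
aggregated configuration -/

/-- Once a strategy has stopped, its run is constant. [cite: MartineauSevero2019, §5 (Structure of the process)] -/
theorem run_add_of_none {X : Type*} (S : CoinStrategy X) {k : ℕ} {c : Set X}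
    (h : S.next (S.run k c) = none) (j : ℕ) : S.run (k + j) c = S.run k c := by
  induction j with
  | zero => rfl
  | succ j ih => rw [← Nat.add_assoc, run_succ_of_none S (by rw [ih]; exact h), ih]

/-- **Inside a block**: after `m K + j` steps (`j < m`, the `K`-th macro-step examining the vertex `q.2`)
the compressed transcript is the `K`-step transcript of `LyonsPeres647Site.stratH` on the aggregated
configuration, `j` copies of `q.2` have been read, and their OR records whether one of the copies
`0, …, j-1` is open. [cite: MartineauSevero2019, §5 (Step 2K+1)] -/
theorem split_run_block (c : Set (W × Fin m)) {K : ℕ}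
    (hK : split m ((stratHm H ι o m).run (m * K) c) = ((stratH H ι o).run K (orAggr c), []))
    {q : W × W} (hq : nextPair H ι (stateOf H ι o ((stratH H ι o).run K (orAggr c))) = some q) :
    ∀ j, j < m →
      (split m ((stratHm H ι o m).run (m * K + j) c)).1 = (stratH H ι o).run K (orAggr c) ∧
      (split m ((stratHm H ι o m).run (m * K + j) c)).2.length = j ∧
      ((split m ((stratHm H ι o m).run (m * K + j) c)).2.any id = true ↔
        ∃ i : ℕ, i < j ∧ (q.2, Fin.ofNat m i) ∈ c) := by
  intro j
  induction j with
  | zero =>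
    intro _
    simp only [Nat.add_zero, hK]
    simp
  | succ j ih =>
    intro hj
    obtain ⟨h1, h2, h3⟩ := ih (by omega)
    set b := (stratHm H ι o m).run (m * K + j) c with hb
    have hn : (stratHm H ι o m).next b = some ⟨{(q.2, Fin.ofNat m j)}, true⟩ := by
      rw [stratHm_next, h1, hq, h2]; rfl
    have hrun : (stratHm H ι o m).run (m * K + (j + 1)) c =
        decide ((q.2, Fin.ofNat m j) ∈ c) :: b := by
      rw [← Nat.add_assoc, hb, run_succ_of_some _ hn, answer_singleton]
    have hne : (split m b).2.length + 1 ≠ m := by rw [h2]; exact Nat.ne_of_lt hj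
    rw [hrun, split_cons_of_ne hne]
    refine ⟨h1, by simp [h2], ?_⟩
    rw [List.any_cons, Bool.or_eq_true, h3]
    simp only [id, decide_eq_true_eq]
    constructor
    · rintro (h | ⟨i, hi, h⟩)
      · exact ⟨j, Nat.lt_succ_self j, h⟩
      · exact ⟨i, by omega, h⟩
    · rintro ⟨i, hi, h⟩
      rcases Nat.lt_succ_iff_lt_or_eq.1 hi with hi | rfl
      · exact Or.inr ⟨i, hi, h⟩
      · exact Or.inl h

/-- **After every `m K` steps the compressed transcript downstairs is the `K`-step transcript of the
one-coin exploration `LyonsPeres647Site.stratH` of the aggregated configuration**, and no block is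
pending. [cite: MartineauSevero2019, §5 ("p̂-percolation on ℋ̂ corresponds to p-percolation on ℋ")] -/
theorem split_run_mul (c : Set (W × Fin m)) (K : ℕ) :
    split m ((stratHm H ι o m).run (m * K) c) = ((stratH H ι o).run K (orAggr c), []) := by
  induction K with
  | zero => simp
  | succ K ih =>
    have hm : 0 < m := NeZero.pos m
    cases hq : nextPair H ι (stateOf H ι o ((stratH H ι o).run K (orAggr c))) with
    | none =>
      -- both explorations have stopped
      have hn : (stratHm H ι o m).next ((stratHm H ι o m).run (m * K) c) = none := by
        rw [stratHm_next, show (split m ((stratHm H ι o m).run (m * K) c)).1 =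
          (stratH H ι o).run K (orAggr c) by rw [ih], hq]; rfl
      have hn' : (stratH H ι o).next ((stratH H ι o).run K (orAggr c)) = none := by
        rw [stratH_next, hq]; rfl
      rw [Nat.mul_succ, run_add_of_none _ hn m, ih, run_succ_of_none _ hn']
    | some q =>
      -- the last copy of `q.2` completes the block; its OR is the aggregated state of the vertex
      have hm1 : m - 1 < m := Nat.sub_lt hm Nat.one_pos
      have hm2 : m - 1 + 1 = m := Nat.sub_add_cancel hm
      have hmul : m * (K + 1) = m * K + (m - 1) + 1 := by rw [Nat.mul_succ, Nat.add_assoc, hm2]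
      obtain ⟨h1, h2, h3⟩ := split_run_block c ih hq (m - 1) hm1
      set b := (stratHm H ι o m).run (m * K + (m - 1)) c with hb
      have hn : (stratHm H ι o m).next b = some ⟨{(q.2, Fin.ofNat m (m - 1))}, true⟩ := by
        rw [stratHm_next, h1, hq, h2]; rfl
      have hrun : (stratHm H ι o m).run (m * (K + 1)) c =
          decide ((q.2, Fin.ofNat m (m - 1)) ∈ c) :: b := by
        rw [hmul, hb, run_succ_of_some _ hn, answer_singleton]
      have heq : (split m b).2.length + 1 = m := by rw [h2, hm2]
      have hn' : (stratH H ι o).next ((stratH H ι o).run K (orAggr c)) = some ⟨{q.2}, true⟩ := by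
        rw [stratH_next, hq]; rfl
      rw [hrun, split_cons_of_eq heq, h1, run_succ_of_some _ hn', answer_singleton]
      congr 2
      -- the OR of the `m` answers is the state of the vertex in the aggregated configuration
      have key : (decide ((q.2, Fin.ofNat m (m - 1)) ∈ c) :: (split m b).2).any id = true ↔
          q.2 ∈ orAggr c := by
        rw [List.any_cons, Bool.or_eq_true, h3, mem_orAggr]
        simp only [id, decide_eq_true_eq]
        constructor
        · rintro (h | ⟨i, -, h⟩)
          · exact ⟨_, h⟩
          · exact ⟨_, h⟩
        · rintro ⟨k, hk⟩
          have hkm : (k : ℕ) < m := k.isLt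
          have hofNat : Fin.ofNat m (k : ℕ) = k := by ext; simp
          rcases Nat.lt_or_ge (k : ℕ) (m - 1) with hlt | hge
          · exact Or.inr ⟨k, hlt, by rw [hofNat]; exact hk⟩
          · have hkeq : (k : ℕ) = m - 1 := Nat.le_antisymm (Nat.le_sub_one_of_lt hkm) hge
            left; rw [← hkeq, hofNat]; exact hk
      by_cases hmem : q.2 ∈ orAggr c
      · rw [decide_eq_true hmem]; exact key.2 hmem
      · rw [decide_eq_false hmem]
        exact Bool.eq_false_iff.2 fun h => hmem (key.1 h)

/-- The explored set read off the compressed transcript grows along the run downstairs.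
[cite: MartineauSevero2019, §5 (Structure of the process)] -/
theorem A_split_run_mono (c : Set (W × Fin m)) :
    Monotone fun k => (stateOf H ι o (split m ((stratHm H ι o m).run k c)).1).A := by
  refine monotone_nat_of_le_succ fun k => ?_
  show (stateOf H ι o (split m ((stratHm H ι o m).run k c)).1).A ⊆
    (stateOf H ι o (split m ((stratHm H ι o m).run (k + 1) c)).1).A
  rw [CoinStrategy.run_succ]
  cases (stratHm H ι o m).next ((stratHm H ι o m).run k c) with
  | none => exact subset_rfl
  | some Qy =>
    rcases split_fst_cons (m := m) (Qy.answer c) ((stratHm H ι o m).run k c) with h | ⟨a', h⟩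
    · simp only [h]; exact subset_rfl
    · simp only [h]; exact A_subset_cons _ _

/-- **Downstairs the exploration exhausts the cluster**: if the site cluster of `o` in the aggregated
configuration (with `o` declared open) is infinite then for every `n` some step has explored `≥ n`
vertices (`LyonsPeres647Site.exists_le_card_A` through `split_run_mul`).
[cite: LyonsPeres2016, §6.9 proof of Thm. 6.47 ("If this procedure never ends")] -/
theorem exists_le_card_A_m (hι : Function.Injective ι) (c : Set (W × Fin m))
    (hinf : (siteCluster H (insert o (orAggr c)) o).Infinite) (n : ℕ) :
    ∃ k, n ≤ (stateOf H ι o (split m ((stratHm H ι o m).run k c)).1).A.card := by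
  obtain ⟨K, hK⟩ := exists_le_card_A hι (orAggr c) hinf n
  exact ⟨m * K, by rw [split_run_mul c K]; exact hK⟩

end HSide

end LyonsPeres647Site

end Literature.Probability.Percolation

end
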